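import Summits.ValiantsHypothesis.ValiantsHypothesis.Theorems.BarrierLeverChowBenchmarkPairsSplit
import Literature.Computability.Complexity.BlockTuples

/-!
# Route BarrierLever — item 22038 `ChowBenchmarkPairs`, line `moore-peel`: SPLIT CERTIFICATES (slot #7 of the registry) —
# part 1: the instance class, the certificate format and the kernel CHECKER

Helper file (`--supports stmt-ValiantsHypothesis-22038`; cell valiant-natproofs, rung V4; seat val-np-p4 gen 24).  Closes NO item.

Memo HOME/val-np-p4/g23/ §4, §13 (spec) and HOME/val-np-p4/g24/.  A MULTI-POINT COORDINATE SPLIT degenerates one coordinate `c` of ALL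
points at once (`P_{a,c} = x^{ρ(a)}`); the lowest-order term of a determinant of Dirichlet-weighted segment entries (`dirE`,
`…ChowBenchmarkPairsSplit`) is the determinant of a LEADING MATRIX selected by integer row/column POTENTIALS (`…SplitLeading`), and the
leading matrix is again a matrix of the same kind.  The closed class («instances», `Inst`): an `n × n` matrix whose entry `(i, j)` is
`s_{ij} · dirE P (S i) (w_{ij}) (T j)` — a natural scalar and a weight PER ENTRY, a support `S i` (≤ 2 points) per row, a coordinate set
`T j` (a binary code) per column (`Inst.matrix`).  Data are plain lists of naturals so that the checker runs by `decide +kernel`.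

A CERTIFICATE is a list of LEVELS (`Level`): `perm σ` reorders the columns; `split c lab ords α β` splits coordinate `c` for ALL
components at once — `lab` labels rows/columns by component (entry `(i, j)` may be nonzero only if `lab i = lab j`), `ords` gives ONE
vertex order (rank list) per label, `α`/`β` are row/column potentials.  `splitStep` checks admissibility entry by entry (`newEnt`: on a
`c`-free column `β j ≤ α i`, the entry survives iff equality; on a `c`-column `β j ≤ ρ(x) + α i` for every support point `x`, at most one
tight, and the survivor is the entry with the weight at the tight point RAISED and the scalar multiplied by the old weight — the
expansion `D_c R^w = Σ_a w_a P_{ac} R^{w+e_a}`) and returns the LEADING INSTANCE.  After all levels the LEAF CHECK (`leafOK`) asks for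
empty codes and a diagonal nonzero scalar pattern.  `check` runs the whole thing.  Soundness («`check = true` ⇒ nonzero generic
determinant») is `…SplitCert.lean`; the entry-level algebra is `…SplitCertEntry.lean`; the root instance of a row family on the first
`n` binary codes is `rootInst` (here, data only).

WHAT THIS IS NOT: no stub of the line is closed; nothing on crux stmt-ValiantsHypothesis-14610 or on `VP` versus `VNP`.
-/

set_option linter.dupNamespace false
set_option autoImplicit false

namespace Summit.ValiantsHypothesis.ValiantsHypothesis.Theorems.BarrierLever.ChowBenchmarkSplit

open Finset Polynomial
open Literature.Computability.Complexity (getD_ofFn)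

namespace Cert

variable {p k n : ℕ}

/-! ## 1. Instances in list form and their matrices -/

/-- A multi-block weighted instance in list form: row supports (lists of ≤ 2 point indices), an `n × n` table of
per-entry data `(s, w₁, w₂)` = (scalar, weight of the first support point, weight of the second), and column codes
(bit `c` set = coordinate `c` belongs to the column). -/
structure Inst where
  /-- row supports -/
  sup : List (List ℕ)
  /-- per-entry data `(s, w₁, w₂)` -/
  ent : List (List (ℕ × ℕ × ℕ))
  /-- column codes -/
  col : List ℕ

/-- Support list of row `i`. -/
def Inst.supL (I : Inst) (i : ℕ) : List ℕ := I.sup.getD i []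
/-- Entry datum `(s, w₁, w₂)` at `(i, j)`. -/
def Inst.entL (I : Inst) (i j : ℕ) : ℕ × ℕ × ℕ := (I.ent.getD i []).getD j (0, 0, 0)
/-- Code of column `j`. -/
def Inst.colN (I : Inst) (j : ℕ) : ℕ := I.col.getD j 0

/-- The weight function of a row with support list `ps` and entry datum `e`, read at the point index `a`. -/
def wOf (ps : List ℕ) (e : ℕ × ℕ × ℕ) (a : ℕ) : ℕ :=
  match ps with
  | [] => 0
  | [x] => if a = x then e.2.1 else 0
  | x :: y :: _ => if a = x then e.2.1 else if a = y then e.2.2 else 0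

/-- The support as a finset of points. -/
def Sof (p : ℕ) (ps : List ℕ) : Finset (Fin p) := Finset.univ.filter fun a => (a : ℕ) ∈ ps
/-- The column as a finset of coordinates (the binary digits of the code). -/
def Tof (k : ℕ) (m : ℕ) : Finset (Fin k) := Finset.univ.filter fun c => Nat.testBit m c
/-- A vertex order given as a list, read as a rank function. -/
def rOf (p : ℕ) (ρ : List ℕ) : Fin p → ℕ := fun a => ρ.getD a 0

/-- **The matrix of an instance** at a table `P` (points `Fin p`, coordinates `Fin k`, size `n`):
entry `(i, j)` is `s_{ij} · dirE P (S i) (w_{ij}) (T j)`. -/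
def Inst.matrix {R : Type*} [CommRing R] (p k n : ℕ) (I : Inst) (P : Fin p → Fin k → R) :
    Matrix (Fin n) (Fin n) R :=
  Matrix.of fun i j => ((I.entL i j).1 : R) *
    dirE P (Sof p (I.supL i)) (fun a => wOf (I.supL i) (I.entL i j) a) (Tof k (I.colN j))

/-! ## 2. The checker -/

/-- Row supports are well formed: length ≤ 2, point indices `< p`, no repetition. -/
def supOK (p n : ℕ) (I : Inst) : Bool :=
  (List.range n).all fun i =>
    decide ((I.supL i).length ≤ 2) && (I.supL i).all (fun a => decide (a < p)) && decide (I.supL i).Nodup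

/-- New entry datum after raising the weight of the FIRST support point (scalar multiplied by the old weight). -/
def raise1 (e : ℕ × ℕ × ℕ) : ℕ × ℕ × ℕ := (e.1 * e.2.1, e.2.1 + 1, e.2.2)
/-- New entry datum after raising the weight of the SECOND support point. -/
def raise2 (e : ℕ × ℕ × ℕ) : ℕ × ℕ × ℕ := (e.1 * e.2.2, e.2.1, e.2.2 + 1)
/-- The killed entry (scalar `0`, weights kept). -/
def kill (e : ℕ × ℕ × ℕ) : ℕ × ℕ × ℕ := (0, e.2.1, e.2.2)

/-- **One entry of a split**: admissibility of the potentials `(a, b)` at this entry and the leading datum.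
`c` = split coordinate, `ρ` = vertex order (rank list) of the row's component, `ps` = row support, `e` = entry datum,
`m` = column code.  Zero entries impose nothing.  On a `c`-free column the entry has valuation `0`: need `b ≤ a`, the
entry survives iff `a = b`.  On a `c`-column the summand of the support point `x` has valuation `ρ x`: need `b ≤ ρ x + a`
for every `x`, at most one `x` tight, and the surviving datum is the entry with the weight at the tight point raised. -/
def newEnt (c : ℕ) (ρ : List ℕ) (a b : ℕ) (ps : List ℕ) (e : ℕ × ℕ × ℕ) (m : ℕ) : Bool × (ℕ × ℕ × ℕ) :=
  if e.1 = 0 then (true, kill e)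
  else if Nat.testBit m c then
    match ps with
    | [] => (true, kill e)
    | [x] =>
      (decide (b ≤ ρ.getD x 0 + a), if ρ.getD x 0 + a = b then raise1 e else kill e)
    | x :: y :: _ =>
      (decide (b ≤ ρ.getD x 0 + a) && decide (b ≤ ρ.getD y 0 + a) &&
          !(decide (ρ.getD x 0 + a = b) && decide (ρ.getD y 0 + a = b)),
        if ρ.getD x 0 + a = b then raise1 e else if ρ.getD y 0 + a = b then raise2 e else kill e)
  else (decide (b ≤ a), if a = b then e else kill e)

/-- The column code after the split: the bit `c` is cleared. -/
def newCol (c m : ℕ) : ℕ := if Nat.testBit m c then m ^^^ 2 ^ c else m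

/-- **A split level** applied to an instance: the admissibility flag and the leading instance.  Data: coordinate `c`
(`< k`), component labels `lab` (row `i` and column `j` may interact only if `lab i = lab j`), one vertex order per label
(`ords`), row potentials `α`, column potentials `β`. -/
def splitStep (k n : ℕ) (c : ℕ) (lab : List ℕ) (ords : List (List ℕ)) (α β : List ℕ) (I : Inst) : Bool × Inst :=
  let okE : ℕ → ℕ → Bool := fun i j =>
    decide ((I.entL i j).1 = 0) ||
      (decide (lab.getD i 0 = lab.getD j 0) &&
        (newEnt c (ords.getD (lab.getD i 0) []) (α.getD i 0) (β.getD j 0) (I.supL i) (I.entL i j) (I.colN j)).1)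
  (decide (c < k) && (List.range n).all fun i => (List.range n).all fun j => okE i j,
    { sup := I.sup
      ent := List.ofFn fun i : Fin n => List.ofFn fun j : Fin n =>
        (newEnt c (ords.getD (lab.getD i 0) []) (α.getD i 0) (β.getD j 0) (I.supL i) (I.entL i j) (I.colN j)).2
      col := List.ofFn fun j : Fin n => newCol c (I.colN j) })

/-- **A permutation level**: the columns are reordered by `σ` (checked to be a permutation of `range n`). -/
def permStep (n : ℕ) (σ : List ℕ) (I : Inst) : Bool × Inst :=
  (((List.range n).all fun j => decide (σ.getD j 0 < n)) && decide (List.ofFn fun j : Fin n => σ.getD j 0).Nodup,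
    { sup := I.sup
      ent := List.ofFn fun i : Fin n => List.ofFn fun j : Fin n => I.entL i (σ.getD j 0)
      col := List.ofFn fun j : Fin n => I.colN (σ.getD j 0) })

/-- **The leaf check**: every column is the empty code and the scalar pattern is diagonal with nonzero diagonal. -/
def leafOK (n : ℕ) (I : Inst) : Bool :=
  (List.range n).all fun i =>
    decide (I.colN i = 0) && !decide ((I.entL i i).1 = 0) &&
      (List.range n).all fun j => decide (j = i) || decide ((I.entL i j).1 = 0)

/-- A certificate level: a column permutation or a one-coordinate split of all components. -/
inductive Level where
  /-- reorder the columns -/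
  | perm (σ : List ℕ) : Level
  /-- split coordinate `c` with component labels, one order per label, row and column potentials -/
  | split (c : ℕ) (lab : List ℕ) (ords : List (List ℕ)) (α β : List ℕ) : Level

/-- **THE CHECKER**: run the levels, then the leaf check. -/
def check (k n : ℕ) : List Level → Inst → Bool
  | [], I => leafOK n I
  | Level.perm σ :: ls, I => (permStep n σ I).1 && check k n ls (permStep n σ I).2
  | Level.split c lab ords α β :: ls, I =>
      (splitStep k n c lab ords α β I).1 && check k n ls (splitStep k n c lab ords α β I).2


/-! ## 5. Reading the list data -/

/-- What `supOK` says about each row. -/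
theorem supOK_spec {I : Inst} (h : supOK p n I = true) (i : Fin n) :
    (I.supL i).length ≤ 2 ∧ (∀ x ∈ I.supL i, x < p) ∧ (I.supL i).Nodup := by
  unfold supOK at h
  rw [List.all_eq_true] at h
  have hi := h i (List.mem_range.mpr i.2)
  simp only [Bool.and_eq_true, decide_eq_true_eq, List.all_eq_true] at hi
  exact ⟨hi.1.1, fun x hx => hi.1.2 x hx, hi.2⟩

section Split

variable (c : ℕ) (lab : List ℕ) (ords : List (List ℕ)) (α β : List ℕ) (I : Inst)

/-- The split keeps the supports. -/
theorem splitStep_supL (i : ℕ) : (splitStep k n c lab ords α β I).2.supL i = I.supL i := rfl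

/-- The entries of the leading instance. -/
theorem splitStep_entL (i j : Fin n) : (splitStep k n c lab ords α β I).2.entL i j =
    (newEnt c (ords.getD (lab.getD i 0) []) (α.getD i 0) (β.getD j 0) (I.supL i) (I.entL i j) (I.colN j)).2 := by
  unfold Inst.entL
  simp only [splitStep]
  rw [getD_ofFn _ _ i.2, getD_ofFn _ _ j.2]
  rfl

/-- The columns of the leading instance. -/
theorem splitStep_colN (j : Fin n) : (splitStep k n c lab ords α β I).2.colN j = newCol c (I.colN j) := by
  unfold Inst.colN
  simp only [splitStep]
  rw [getD_ofFn _ _ j.2]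
  rfl

/-- What the Boolean of a split says. -/
theorem splitStep_ok (h : (splitStep k n c lab ords α β I).1 = true) :
    c < k ∧ ∀ i j : Fin n, (I.entL i j).1 = 0 ∨ (lab.getD i 0 = lab.getD j 0 ∧
      (newEnt c (ords.getD (lab.getD i 0) []) (α.getD i 0) (β.getD j 0) (I.supL i) (I.entL i j) (I.colN j)).1 = true) := by
  simp only [splitStep, Bool.and_eq_true, decide_eq_true_eq, List.all_eq_true, List.mem_range, Bool.or_eq_true] at h
  exact ⟨h.1, fun i j => h.2 i i.2 j j.2⟩

end Split

section Perm

variable (σ : List ℕ) (I : Inst)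

/-- The permutation keeps the supports. -/
theorem permStep_supL (i : ℕ) : (permStep n σ I).2.supL i = I.supL i := rfl

/-- The entries after the permutation. -/
theorem permStep_entL (i j : Fin n) : (permStep n σ I).2.entL i j = I.entL i (σ.getD j 0) := by
  unfold Inst.entL
  simp only [permStep]
  rw [getD_ofFn _ _ i.2, getD_ofFn _ _ j.2]
  rfl

/-- The columns after the permutation. -/
theorem permStep_colN (j : Fin n) : (permStep n σ I).2.colN j = I.colN (σ.getD j 0) := by
  unfold Inst.colN
  simp only [permStep]
  rw [getD_ofFn _ _ j.2]
  rfl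

/-- What the Boolean of a permutation level says. -/
theorem permStep_ok (h : (permStep n σ I).1 = true) :
    (∀ j : Fin n, σ.getD j 0 < n) ∧ Function.Injective (fun j : Fin n => σ.getD j 0) := by
  simp only [permStep, Bool.and_eq_true, decide_eq_true_eq, List.all_eq_true, List.mem_range] at h
  exact ⟨fun j => h.1 j j.2, List.nodup_ofFn.mp h.2⟩

end Perm

/-! ## 7. The root instance of a row family on the first `n` binary codes -/

section Root

/-- **The root instance** of a row family (supports as lists of point indices) on the first `n` binary codes:
all weights `1`, scalar `1` — except scalar `0` for the empty row at a nonzero code (where the entry vanishes anyway). -/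
def rootInst (rows : List (List ℕ)) (n : ℕ) : Inst where
  sup := rows
  ent := List.ofFn fun i : Fin n => List.ofFn fun j : Fin n =>
    (if (rows.getD i []).isEmpty && !decide ((j : ℕ) = 0) then 0 else 1, 1, 1)
  col := List.range n

/-- The supports of the root instance. -/
theorem rootInst_supL (rows : List (List ℕ)) (i : ℕ) : (rootInst rows n).supL i = rows.getD i [] := rfl

/-- The columns of the root instance are the codes `j`. -/
theorem rootInst_colN (rows : List (List ℕ)) (j : Fin n) : (rootInst rows n).colN j = j := by
  unfold Inst.colN rootInst
  rw [List.getD_eq_getElem _ _ (by simp), List.getElem_range]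

/-- The entries of the root instance. -/
theorem rootInst_entL (rows : List (List ℕ)) (i j : Fin n) : (rootInst rows n).entL i j =
    (if (rows.getD i []).isEmpty && !decide ((j : ℕ) = 0) then 0 else 1, 1, 1) := by
  unfold Inst.entL rootInst
  rw [getD_ofFn _ _ i.2, getD_ofFn _ _ j.2]

end Root

end Cert

end Summit.ValiantsHypothesis.ValiantsHypothesis.Theorems.BarrierLever.ChowBenchmarkSplit
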